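import Literature.NumberTheory.Automorphic.PlaneLatticesSelfDualGlued            -- ★ p840702 (L5-b) B-p04: self-duality iff, per-stratum count (+ ★ p840624 (L5-a) Hermite currency)
import Literature.NumberTheory.Automorphic.UnitaryGroupSelfDualLocus              -- ★ L1: `exists_mem_glInt_coe_eq_formCongr` (GL₂(𝒪) preserves unimodular Gram matrices)
import Literature.NumberTheory.Automorphic.UnitaryConjClassClosed                 -- ★ `formCongr_mul`
import Literature.NumberTheory.LocalFields.UnramifiedQuadraticNormFibres          -- ★ p840590 (L5-c): `natCard_norm_fibre_quotient_pow`
import HarnessLib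

/-!
# The NORMALISED count of self-dual `γ`-stable lattices in a hermitian plane: `#S(ϖ^e·1, diag(a,c)) = Σ_{j ≤ N, j ≡ e (2)} w(j)`,
# `w(0) = 1`, `w(j) = q^{j−1}(q+1)`, `N = v(a − c)` (Flicker 1998, §6 p. 95: the H-side lattice count, eigenframe form)

Topic `NumberTheory/Automorphic`; namespace `Literature.NumberTheory.Automorphic`.  THEOREMS ONLY (no definition, no instance, no notation, no named fact,
no `sorry`).  Cell `pub/hodgecm-mathlib`, F0∕P3a road «D-N7-inert», brick **(L5-d3)** of the H-side count (L5) ∕ MAP v3 (F9) (B-p10 (g24), integrator; PRE-CENSUS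
bf72064b4f0257e1 §2 (iii)–(vi)).  HC_CM is proved only modulo the printed citations until rung 0 closes; nothing printed is a letter here.

THE SET.  For a field `F` with a valuative relation, `σ : F →+* F`, a form `H` and `γ ∈ GL₂(F)`, the socket's set of `γ`-stable `H`-self-dual lattices is written
INLINE, token-exact as in ★ `UnitaryUnitOrbitalIntegralLatticeCount` §3 ∕ ★-bound (L5-d1) `SelfDualLatticeCountFrameTransport`:
`S(H, γ) = {Λ : Submodule 𝒪[F] (Fin 2 → F) | (∃ g : GL (Fin 2) F, (∃ J′ ∈ glInt 2 F, ↑J′ = formCongr σ g H) ∧ Λ = span 𝒪[F] (range (↑g)ᵀ)) ∧ Λ.map (toLin' ↑γ) = Λ}`.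
Here `H = ϖ^e • 1` (`e ∈ {0, 1}`, the two Gram parities = Flicker's two classes `t₁, t₂`) and `↑γ = !![a, 0; 0, c]` (the eigenframe of an elliptic regular element,
`|a| = |c| = 1`, `|a − c| = |ϖ^N|`).

THE COUNT (eigenframe gluing route).  By ★ (L5-a) every lattice is `Λ(T(k,y,l))`, `T(k,y,l) = !![ϖ^k, y; 0, ϖ^l]`, with `(k, l, y mod ϖ^k)` unique; self-duality for
`ϖ^e • 1` forces `l = −k − e`, `j := 2k + e ≥ 0` and `u := ϖ^{k+e} y ∈ 𝒪` with `u σu ≡ −1 (mod ϖ^j)` (★ (L5-b) p840702, B-p04 (g33));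
`γ`-stability is `j ≤ N` (★ `map_diag_span_eq_self_iff_of_hermite`; `u` is a unit once `j ≥ 1`, ★ (L5-b)); for each admissible `j` the classes `u mod ϖ^j` number
`w(j) = q^{j−1}(q+1)` (★ (L5-c) `natCard_norm_fibre_quotient_pow`, `r = −1`; `j = 0`: one lattice).  Summing over `j ≤ N`, `j ≡ e`:
**`ncard_selfDualStable_smul_one_diag_eq_sum`** — `(S(ϖ^e • 1, diag(a,c))).ncard = ∑ j ∈ (range (N+1)).filter (· % 2 = e), w q j`, the `S₀`∕`S₁` slot of ★ p840679
`stableOrbitalIntegralRel_indicator_eq_div_of_two_classes_of_values` after ★-bound (L5-d1) frame transport.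

## References
* [Flicker1998UnitaryFL] Y. Z. Flicker, *Elementary proof of the fundamental lemma for a unitary group*, Canad. J. Math. 50 (1998), §4 Lemma I.I.1 p. 84, §6 p. 95 + REMARK.
* [Rogawski1990] J. D. Rogawski, *Automorphic Representations of Unitary Groups in Three Variables* (1990), §4.9 Lemma 4.9.3 p. 61.
* [Macdonald1995] I. G. Macdonald, *Symmetric functions and Hall polynomials* (1995), Ch. V §2.
-/

set_option autoImplicit false

noncomputable section

open scoped ValuativeRel Matrix MatrixGroups
open Matrix ValuativeRel Finset IsLocalRing

namespace Literature.NumberTheory.Automorphic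

variable {F : Type*} [Field F] [ValuativeRel F] (σ : F →+* F) {ϖ : F} (hϖ : IsUniformizingElement ϖ)

/-! ## §1 Self-duality is a property of the LATTICE (independent of the representative `g`) -/

/-- If `Λ(g) = Λ(g′)` then `g′ = g κ` with `κ ∈ GL₂(𝒪)` (★ `span_range_transpose_eq_iff`), and `GL₂(𝒪)` preserves unimodularity of Gram matrices when `σ(𝒪) ⊆ 𝒪`
(★ `exists_mem_glInt_coe_eq_formCongr`): so `H`-self-duality passes from `g` to `g′`. [cite: Flicker1998UnitaryFL, §4 Lemma I.I.1 p. 84] -/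
theorem exists_mem_glInt_coe_eq_formCongr_of_span_eq (hσO : ∀ x : 𝒪[F], σ x ∈ 𝒪[F]) (H : Matrix (Fin 2) (Fin 2) F) {g g' : GL (Fin 2) F}
    (hΛ : Submodule.span 𝒪[F] (Set.range ((g : Matrix (Fin 2) (Fin 2) F))ᵀ) = Submodule.span 𝒪[F] (Set.range ((g' : Matrix (Fin 2) (Fin 2) F))ᵀ))
    (h : ∃ J' ∈ glInt 2 F, (J' : Matrix (Fin 2) (Fin 2) F) = formCongr σ g H) :
    ∃ J' ∈ glInt 2 F, (J' : Matrix (Fin 2) (Fin 2) F) = formCongr σ g' H := by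
  obtain ⟨J₁, hJ₁, hJ₁e⟩ := h
  have hκ : g⁻¹ * g' ∈ glInt 2 F := (span_range_transpose_eq_iff g g').1 hΛ
  obtain ⟨J', hJ', hJ'e⟩ := UnitaryGroup.exists_mem_glInt_coe_eq_formCongr σ hσO J₁ hJ₁ (g⁻¹ * g') hκ
  refine ⟨J', hJ', ?_⟩
  rw [hJ'e, hJ₁e, ← formCongr_mul, mul_inv_cancel_left]

/-! ## §2 The `u`-coordinate: units, and `γ`-stability as `j ≤ N` -/

include hϖ in
/-- **`γ`-stability in the `u`-coordinate is `j ≤ N`**: for `↑γ = diag(a, c)` with `|a − c| = |ϖ^N|`, a Hermite lattice `Λ(T(k, y, l))` with `y = ϖ^{−(k+e)} u`, `|u| = 1`,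
`j = 2k + e`, is `γ`-stable iff `j ≤ N` (★ `map_diag_span_eq_self_iff_of_hermite`: stable iff `ϖ^{−k}(a − c)y = ϖ^{−j}(a − c)u ∈ 𝒪`).
[cite: Flicker1998UnitaryFL, §6 p. 95] [cite: Macdonald1995, Ch. V §2] -/
theorem map_diag_span_eq_self_iff_le_of_unit {k e : ℤ} {u a c : F} {N : ℕ} (γ g : GL (Fin 2) F) (hγ : (γ : Matrix (Fin 2) (Fin 2) F) = !![a, 0; 0, c])
    (ha : valuation F a = 1) (hc : valuation F c = 1) (hN : valuation F (a - c) = valuation F (ϖ ^ N))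
    (hg : (g : Matrix (Fin 2) (Fin 2) F) = !![ϖ ^ k, ϖ ^ (-(k + e)) * u; 0, ϖ ^ (-k - e)]) (hu1 : valuation F u = 1) :
    (Submodule.span 𝒪[F] (Set.range ((g : Matrix (Fin 2) (Fin 2) F))ᵀ)).map
        ((Matrix.toLin' (γ : Matrix (Fin 2) (Fin 2) F)).restrictScalars 𝒪[F]) =
      Submodule.span 𝒪[F] (Set.range ((g : Matrix (Fin 2) (Fin 2) F))ᵀ) ↔ 2 * k + e ≤ N := by
  rw [map_diag_span_eq_self_iff_of_hermite hϖ γ g hγ ha hc hg]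
  -- `ϖ^{−k}((a − c) ϖ^{−(k+e)} u) = ϖ^{−(2k+e)} (a − c) u`, and `(a − c) = ϖ^N · ε`, `|ε| = 1`
  have h0 := hϖ.ne_zero
  have key : ϖ ^ (-k) * ((a - c) * (ϖ ^ (-(k + e)) * u)) = ϖ ^ ((N : ℤ) - (2 * k + e)) * ((a - c) * ϖ ^ (-(N : ℤ)) * u) := by
    rw [show (N : ℤ) - (2 * k + e) = -k + (-(k + e)) + N by ring, zpow_add₀ h0, zpow_add₀ h0]
    have : (ϖ : F) ^ (N : ℤ) * ϖ ^ (-(N : ℤ)) = 1 := by rw [← zpow_add₀ h0, add_neg_cancel, zpow_zero]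
    calc ϖ ^ (-k) * ((a - c) * (ϖ ^ (-(k + e)) * u)) = ϖ ^ (-k) * ϖ ^ (-(k + e)) * 1 * ((a - c) * u) := by ring
      _ = ϖ ^ (-k) * ϖ ^ (-(k + e)) * (ϖ ^ (N : ℤ) * ϖ ^ (-(N : ℤ))) * ((a - c) * u) := by rw [this]
      _ = ϖ ^ (-k) * ϖ ^ (-(k + e)) * ϖ ^ (N : ℤ) * ((a - c) * ϖ ^ (-(N : ℤ)) * u) := by ring
  have hε : valuation F ((a - c) * ϖ ^ (-(N : ℤ)) * u) = 1 := by
    rw [map_mul, map_mul, hN, hu1, mul_one, ← map_mul, ← zpow_natCast, ← zpow_add₀ h0, add_neg_cancel, zpow_zero, map_one]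
  rw [key]
  constructor
  · intro hmem
    have hval : valuation F (ϖ ^ ((N : ℤ) - (2 * k + e))) ≤ 1 := by
      have := (Valuation.mem_integer_iff _ _).1 hmem
      rwa [map_mul, hε, mul_one] at this
    have hmem' : ϖ ^ ((N : ℤ) - (2 * k + e)) ∈ 𝒪[F] := (Valuation.mem_integer_iff _ _).2 hval
    have := (zpow_uniformizer_mem_integer_iff hϖ _).1 hmem'
    omega
  · intro hle
    refine (Valuation.mem_integer_iff _ _).2 ?_
    rw [map_mul, hε, mul_one]
    exact (Valuation.mem_integer_iff _ _).1 ((zpow_uniformizer_mem_integer_iff hϖ _).2 (by omega))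

/-! ## §3 Membership in `S(ϖ^e • 1, diag(a,c))` through the Hermite strata `S_k` (over the ★ (L5-b) heads) -/

section Strata

variable {σ}
variable (hσϖ : σ ϖ = ϖ) (hσO : ∀ x ∈ 𝒪[F], σ x ∈ 𝒪[F]) {e : ℕ}
  {a c : F} {N : ℕ} (γ : GL (Fin 2) F) (hγ : (γ : Matrix (Fin 2) (Fin 2) F) = !![a, 0; 0, c])
  (ha : valuation F a = 1) (hc : valuation F c = 1) (hN : valuation F (a - c) = valuation F (ϖ ^ N))

include hϖ hσϖ hσO hγ ha hc hN in
/-- **A self-dual Hermite lattice `Λ(T(k, y, −k−e))` is `γ`-stable iff `2k + e ≤ N`** (★ (L5-b) `map_diag_span_eq_self_iff_of_selfDual_hermite` gives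
`ϖ^{−j}(a − c) ∈ 𝒪`; here read against `|a − c| = |ϖ^N|`). [cite: Flicker1998UnitaryFL, §6 p. 95] -/
theorem map_diag_span_eq_self_iff_le_of_selfDual {k : ℤ} {y : F} (g : GL (Fin 2) F)
    (hg : (g : Matrix (Fin 2) (Fin 2) F) = !![ϖ ^ k, y; 0, ϖ ^ (-k - e)])
    (hsd : ∃ J' ∈ glInt 2 F, (J' : Matrix (Fin 2) (Fin 2) F) = formCongr σ g ((ϖ ^ (e : ℤ)) • (1 : Matrix (Fin 2) (Fin 2) F))) :
    (Submodule.span 𝒪[F] (Set.range ((g : Matrix (Fin 2) (Fin 2) F))ᵀ)).map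
        ((Matrix.toLin' (γ : Matrix (Fin 2) (Fin 2) F)).restrictScalars 𝒪[F]) =
      Submodule.span 𝒪[F] (Set.range ((g : Matrix (Fin 2) (Fin 2) F))ᵀ) ↔ 2 * k + e ≤ N := by
  have h0 := hϖ.ne_zero
  obtain ⟨-, hj, hu, hcong⟩ := (exists_mem_glInt_coe_eq_formCongr_hermite_iff hϖ σ hσϖ hσO g hg).1 hsd
  -- the `u`-coordinate `u := ϖ^{k+e} y`, `y = ϖ^{−(k+e)} u`
  have hy : y = ϖ ^ (-(k + e)) * (ϖ ^ (k + e) * y) := by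
    rw [← mul_assoc, ← zpow_add₀ h0, neg_add_cancel, zpow_zero, one_mul]
  rcases (show 2 * k + (e : ℤ) = 0 ∨ 1 ≤ 2 * k + (e : ℤ) by omega) with hj0 | hj1
  · -- `j = 0`: then `k + e = −k`, so `u = ϖ^{−k} y ∈ 𝒪` and stability `ϖ^{−k}(a − c) y = (a − c) u ∈ 𝒪` is automatic
    have hke : k + (e : ℤ) = -k := by omega
    rw [map_diag_span_eq_self_iff_of_hermite hϖ γ g hγ ha hc hg, hj0]
    refine iff_of_true ?_ (Int.natCast_nonneg N)
    have hac : a - c ∈ 𝒪[F] := (Valuation.mem_integer_iff _ _).2 (by rw [hN]; exact (Valuation.mem_integer_iff _ _).1 (hϖ.pow_mem N))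
    rw [show ϖ ^ (-k) * ((a - c) * y) = (a - c) * (ϖ ^ (k + (e : ℤ)) * y) by rw [hke]; ring]
    exact (𝒪[F]).mul_mem hac hu
  · have hu1 : valuation F (ϖ ^ (k + e) * y) = 1 :=
      valuation_eq_one_of_norm_congr hϖ σ hσO hj1 hu hcong
    have hg' : (g : Matrix (Fin 2) (Fin 2) F) = !![ϖ ^ k, ϖ ^ (-(k + e)) * (ϖ ^ (k + e) * y); 0, ϖ ^ (-k - e)] := by rw [← hy]; exact hg
    exact map_diag_span_eq_self_iff_le_of_unit hϖ γ g hγ ha hc hN hg' hu1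

include hϖ hσϖ hσO hγ ha hc hN in
/-- **MEMBERSHIP**: `Λ ∈ S(ϖ^e • 1, diag(a,c))` iff `Λ` is a SELF-DUAL Hermite lattice `Λ(T(k, y, −k−e))` with `2k + e ≤ N` (★ (L5-a) existence + §1 + ★ (L5-b) + stability).
[cite: Flicker1998UnitaryFL, §6 p. 95] [cite: Macdonald1995, Ch. V §2] -/
theorem mem_selfDualStable_smul_one_diag_iff [IsDiscreteValuationRing 𝒪[F]] (Λ : Submodule 𝒪[F] (Fin 2 → F)) :
    Λ ∈ {Λ : Submodule 𝒪[F] (Fin 2 → F) |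
        (∃ g : GL (Fin 2) F, (∃ J' ∈ glInt 2 F, (J' : Matrix (Fin 2) (Fin 2) F) = formCongr σ g ((ϖ ^ (e : ℤ)) • (1 : Matrix (Fin 2) (Fin 2) F))) ∧
          Λ = Submodule.span 𝒪[F] (Set.range ((g : Matrix (Fin 2) (Fin 2) F))ᵀ)) ∧
        Λ.map ((Matrix.toLin' (γ : Matrix (Fin 2) (Fin 2) F)).restrictScalars 𝒪[F]) = Λ} ↔
      ∃ (k : ℤ) (y : F) (g : GL (Fin 2) F), (g : Matrix (Fin 2) (Fin 2) F) = !![ϖ ^ k, y; 0, ϖ ^ (-k - e)] ∧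
        (∃ J' ∈ glInt 2 F, (J' : Matrix (Fin 2) (Fin 2) F) = formCongr σ g ((ϖ ^ (e : ℤ)) • (1 : Matrix (Fin 2) (Fin 2) F))) ∧
        Λ = Submodule.span 𝒪[F] (Set.range ((g : Matrix (Fin 2) (Fin 2) F))ᵀ) ∧ 2 * k + e ≤ N := by
  constructor
  · rintro ⟨⟨g₀, hsd₀, rfl⟩, hstab⟩
    obtain ⟨k, l, y, g, hg, hΛ⟩ := exists_hermite_span_eq hϖ g₀
    have hsd : ∃ J' ∈ glInt 2 F, (J' : Matrix (Fin 2) (Fin 2) F) = formCongr σ g ((ϖ ^ (e : ℤ)) • (1 : Matrix (Fin 2) (Fin 2) F)) :=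
      exists_mem_glInt_coe_eq_formCongr_of_span_eq σ (fun x => hσO x x.2) _ hΛ hsd₀
    obtain ⟨hl, -, -, -⟩ := (exists_mem_glInt_coe_eq_formCongr_hermite_iff hϖ σ hσϖ hσO g hg).1 hsd
    subst hl
    refine ⟨k, y, g, hg, hsd, hΛ, ?_⟩
    rw [hΛ] at hstab
    exact (map_diag_span_eq_self_iff_le_of_selfDual hϖ hσϖ hσO γ hγ ha hc hN g hg hsd).1 hstab
  · rintro ⟨k, y, g, hg, hsd, rfl, hle⟩
    exact ⟨⟨g, hsd, rfl⟩, (map_diag_span_eq_self_iff_le_of_selfDual hϖ hσϖ hσO γ hγ ha hc hN g hg hsd).2 hle⟩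

include hϖ in
/-- **The strata are disjoint in `k`**: a lattice in Hermite form has a unique first exponent (★ `span_eq_span_iff_of_hermite`). [cite: Macdonald1995, Ch. V §2] -/
theorem eq_of_span_hermite_eq_span_hermite {k k' l l' : ℤ} {y y' : F} (g g' : GL (Fin 2) F)
    (hg : (g : Matrix (Fin 2) (Fin 2) F) = !![ϖ ^ k, y; 0, ϖ ^ l]) (hg' : (g' : Matrix (Fin 2) (Fin 2) F) = !![ϖ ^ k', y'; 0, ϖ ^ l'])
    (h : Submodule.span 𝒪[F] (Set.range ((g : Matrix (Fin 2) (Fin 2) F))ᵀ) = Submodule.span 𝒪[F] (Set.range ((g' : Matrix (Fin 2) (Fin 2) F))ᵀ)) :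
    k = k' :=
  ((span_eq_span_iff_of_hermite hϖ g g' hg hg').1 h).1

end Strata

/-! ## §4 The count -/

section Count

variable {σ}
variable (σO : 𝒪[F] →+* 𝒪[F]) (hσO' : ∀ x : 𝒪[F], ((σO x : 𝒪[F]) : F) = σ x) (hσσ : ∀ x, σO (σO x) = x)

/-- **The per-stratum value**: `#{x ∈ 𝒪∕𝓂^j : x σ̄x = −1} = w(j)` — `1` for `j = 0` (the quotient by `𝓂^0 = ⊤` is a point), `q^{j−1}(q+1)` for `j ≥ 1` (★ (L5-c)
`natCard_norm_fibre_quotient_pow` at `r = −1`). [cite: Flicker1998UnitaryFL, §6 p. 95 REMARK] -/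
theorem natCard_norm_fibre_neg_one_eq_gluingWeight [IsDiscreteValuationRing 𝒪[F]] [Finite (ResidueField 𝒪[F])]
    [IsAdicComplete (maximalIdeal 𝒪[F]) 𝒪[F]] {a₀ : 𝒪[F]} (ha₀ : IsUnit (σO a₀ - a₀)) {q : ℕ} (hq : Nat.card (ResidueField 𝒪[F]) = q ^ 2) (j : ℕ) :
    Nat.card {x : 𝒪[F] ⧸ maximalIdeal 𝒪[F] ^ j //
        x * Ideal.quotientMap (maximalIdeal 𝒪[F] ^ j) σO (LocalFields.UnramifiedQuadraticNorm.maximalIdeal_pow_le_comap σO hσσ j) x =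
          Ideal.Quotient.mk _ (-1)} = if j = 0 then 1 else q ^ (j - 1) * (q + 1) := by
  rcases Nat.eq_zero_or_pos j with rfl | hj
  · rw [if_pos rfl]
    haveI : Subsingleton (𝒪[F] ⧸ maximalIdeal 𝒪[F] ^ 0) := Ideal.Quotient.subsingleton_iff.2 (by rw [pow_zero, Ideal.one_eq_top])
    exact Nat.card_of_subsingleton ⟨0, Subsingleton.elim _ _⟩
  · rw [if_neg (Nat.pos_iff_ne_zero.1 hj)]
    exact LocalFields.UnramifiedQuadraticNorm.natCard_norm_fibre_quotient_pow σO hσσ ha₀ hq hj isUnit_one.neg (by rw [map_neg, map_one])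

variable (hσϖ : σ ϖ = ϖ) {e : ℕ} (he : e ≤ 1)
  {a c : F} {N : ℕ} (γ : GL (Fin 2) F) (hγ : (γ : Matrix (Fin 2) (Fin 2) F) = !![a, 0; 0, c])
  (ha : valuation F a = 1) (hc : valuation F c = 1) (hN : valuation F (a - c) = valuation F (ϖ ^ N))

include hϖ hσO' hσσ hσϖ he hγ ha hc hN in
/-- **THE NORMALISED H-SIDE LATTICE COUNT** (eigenframe gluing route): for `e ∈ {0, 1}`, `↑γ = diag(a, c)` with `|a| = |c| = 1`, `|a − c| = |ϖ^N|`, over a complete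
discretely valued `F` whose residue field of `𝒪` has `q²` elements and `σ` an involution of `𝒪` moving some element by a unit (the unramified quadratic setting):
`#S(ϖ^e • 1, γ) = Σ_{j ≤ N, j ≡ e (2)} w(j)`, `w(0) = 1`, `w(j) = q^{j−1}(q+1)` — over the ★ (L5-b) heads `exists_mem_glInt_coe_eq_formCongr_hermite_iff` (self-duality of a
Hermite lattice for `ϖ^e • 1`) and `ncard_selfDual_hermite_eq_natCard` (the `k`-stratum is in bijection with `{x ∈ 𝒪∕𝓂^{2k+e} : x σ̄x = −1}`).  The strata `k` with
`2k + e = j ≤ N` are disjoint (★ uniqueness of the Hermite exponent), exhaust `S` (§3), and have `w(j)` elements (★ (L5-c)). [cite: Flicker1998UnitaryFL, §6 p. 95 + REMARK] [cite: Rogawski1990, §4.9 Lemma 4.9.3 p. 61] -/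
theorem ncard_selfDualStable_smul_one_diag_eq_sum [IsDiscreteValuationRing 𝒪[F]] [Finite (ResidueField 𝒪[F])]
    [IsAdicComplete (maximalIdeal 𝒪[F]) 𝒪[F]] {a₀ : 𝒪[F]} (ha₀ : IsUnit (σO a₀ - a₀)) {q : ℕ} (hq : Nat.card (ResidueField 𝒪[F]) = q ^ 2) :
    {Λ : Submodule 𝒪[F] (Fin 2 → F) |
        (∃ g : GL (Fin 2) F, (∃ J' ∈ glInt 2 F, (J' : Matrix (Fin 2) (Fin 2) F) = formCongr σ g ((ϖ ^ (e : ℤ)) • (1 : Matrix (Fin 2) (Fin 2) F))) ∧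
          Λ = Submodule.span 𝒪[F] (Set.range ((g : Matrix (Fin 2) (Fin 2) F))ᵀ)) ∧
        Λ.map ((Matrix.toLin' (γ : Matrix (Fin 2) (Fin 2) F)).restrictScalars 𝒪[F]) = Λ}.ncard =
      ∑ j ∈ (range (N + 1)).filter (fun j => j % 2 = e), (if j = 0 then 1 else q ^ (j - 1) * (q + 1)) := by
  classical
  have hσO : ∀ x ∈ 𝒪[F], σ x ∈ 𝒪[F] := fun x hx => by rw [← hσO' ⟨x, hx⟩]; exact (σO ⟨x, hx⟩).2
  -- the strata, indexed by `j = 2k + e`, `k(j) := (j − e) / 2`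
  set T : ℤ → Set (Submodule 𝒪[F] (Fin 2 → F)) := fun k =>
    {Λ | ∃ (y : F) (g : GL (Fin 2) F), (g : Matrix (Fin 2) (Fin 2) F) = !![ϖ ^ k, y; 0, ϖ ^ (-k - e)] ∧
        (∃ J' ∈ glInt 2 F, (J' : Matrix (Fin 2) (Fin 2) F) = formCongr σ g ((ϖ ^ (e : ℤ)) • (1 : Matrix (Fin 2) (Fin 2) F))) ∧
        Λ = Submodule.span 𝒪[F] (Set.range ((g : Matrix (Fin 2) (Fin 2) F))ᵀ)} with hT
  set J : Finset ℕ := (range (N + 1)).filter (fun j => j % 2 = e) with hJ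
  have hkj : ∀ j ∈ J, 2 * (((j - e) / 2 : ℕ) : ℤ) + e = (j : ℕ) ∧ j ≤ N := fun j hj => by
    simp only [hJ, Finset.mem_filter, Finset.mem_range] at hj
    constructor <;> omega
  -- per-stratum value and finiteness
  have hval : ∀ j ∈ J, (T (((j - e) / 2 : ℕ) : ℤ)).ncard = if j = 0 then 1 else q ^ (j - 1) * (q + 1) := fun j hj => by
    have hjn : (2 * (((j - e) / 2 : ℕ) : ℤ) + (e : ℤ)).toNat = j := by have := (hkj j hj).1; omega
    refine (ncard_selfDual_hermite_eq_natCard hϖ σ hσϖ σO hσO' hσσ (k := (((j - e) / 2 : ℕ) : ℤ)) (e := (e : ℤ))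
      (by have := (hkj j hj).1; omega)).trans ?_
    rw [natCard_norm_fibre_neg_one_eq_gluingWeight σO hσσ ha₀ hq, hjn]
  have hq1 : 1 ≤ q := by
    rcases Nat.eq_zero_or_pos q with rfl | h
    · haveI : Finite (ResidueField 𝒪[F]) := inferInstance
      rw [zero_pow two_ne_zero] at hq
      exact absurd hq (Nat.card_pos (α := ResidueField 𝒪[F])).ne'
    · exact h
  have hfin : ∀ j ∈ J, (T (((j - e) / 2 : ℕ) : ℤ)).Finite := fun j hj => by
    refine Set.finite_of_ncard_ne_zero ?_
    rw [hval j hj]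
    split_ifs
    · exact one_ne_zero
    · exact Nat.mul_ne_zero (pow_ne_zero _ (by omega)) (by omega)
  -- `S = ⋃_{j ∈ J} T (k j)` as a finite `biUnion`
  set U : Finset (Submodule 𝒪[F] (Fin 2 → F)) := J.attach.biUnion fun j => (hfin j.1 j.2).toFinset with hU
  have hSU : {Λ : Submodule 𝒪[F] (Fin 2 → F) |
        (∃ g : GL (Fin 2) F, (∃ J' ∈ glInt 2 F, (J' : Matrix (Fin 2) (Fin 2) F) = formCongr σ g ((ϖ ^ (e : ℤ)) • (1 : Matrix (Fin 2) (Fin 2) F))) ∧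
          Λ = Submodule.span 𝒪[F] (Set.range ((g : Matrix (Fin 2) (Fin 2) F))ᵀ)) ∧
        Λ.map ((Matrix.toLin' (γ : Matrix (Fin 2) (Fin 2) F)).restrictScalars 𝒪[F]) = Λ} = (U : Set (Submodule 𝒪[F] (Fin 2 → F))) := by
    ext Λ
    rw [mem_selfDualStable_smul_one_diag_iff hϖ hσϖ hσO γ hγ ha hc hN Λ, hU, Finset.coe_biUnion]
    simp only [Finset.mem_coe, Finset.mem_attach, Set.iUnion_true, Set.mem_iUnion, Set.Finite.coe_toFinset]
    constructor
    · rintro ⟨k, y, g, hg, hsd, hΛ, hle⟩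
      obtain ⟨-, hj0, -, -⟩ := (exists_mem_glInt_coe_eq_formCongr_hermite_iff hϖ σ hσϖ hσO g hg).1 hsd
      have hjJ : (2 * k + e).toNat ∈ J := by
        simp only [hJ, Finset.mem_filter, Finset.mem_range]; constructor <;> omega
      refine ⟨⟨_, hjJ⟩, ?_⟩
      have hk : ((((2 * k + (e : ℤ)).toNat - e) / 2 : ℕ) : ℤ) = k := by omega
      rw [hT]; simp only [Set.mem_setOf_eq]
      rw [hk]
      exact ⟨y, g, hg, hsd, hΛ⟩
    · rintro ⟨⟨j, hj⟩, hmem⟩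
      rw [hT] at hmem; simp only [Set.mem_setOf_eq] at hmem
      obtain ⟨y, g, hg, hsd, hΛ⟩ := hmem
      exact ⟨_, y, g, hg, hsd, hΛ, by have := hkj j hj; omega⟩
  -- disjointness of the strata
  have hdisj : (↑J.attach : Set {j // j ∈ J}).PairwiseDisjoint fun j => (hfin j.1 j.2).toFinset := by
    rintro ⟨j, hj⟩ - ⟨j', hj'⟩ - hne
    rw [Function.onFun, Set.Finite.disjoint_toFinset, Set.disjoint_left]
    rintro Λ hΛ hΛ'
    rw [hT] at hΛ hΛ'
    simp only [Set.mem_setOf_eq] at hΛ hΛ'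
    obtain ⟨y, g, hg, -, hΛg⟩ := hΛ
    obtain ⟨y', g', hg', -, hΛg'⟩ := hΛ'
    have hk := eq_of_span_hermite_eq_span_hermite hϖ g g' hg hg' (hΛg.symm.trans hΛg')
    have h1 := (hkj j hj).1; have h2 := (hkj j' hj').1
    exact hne (Subtype.ext (show j = j' by omega))
  rw [hSU, Set.ncard_coe_finset, hU, Finset.card_biUnion hdisj, ← Finset.sum_attach J]
  refine Finset.sum_congr rfl fun j _ => ?_
  rw [← Set.ncard_eq_toFinset_card _ (hfin j.1 j.2), hval j.1 j.2]

end Count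

end Literature.NumberTheory.Automorphic

end
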